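import Literature.Computability.QuantumComplexity.StrandCompress
import HarnessLib

/-!
# The compressed braid word in closed form

Topic `Literature/Computability/QuantumComplexity`; a step in the discharge of
`ajl_jonesApproxProblem_mem_PromiseBQP` (and, through `PromiseBQPOverTransport.lean`, of
`ajl_mem_PromiseBQPOver_ajlGateSet`): the classical pre-processing of an AJL instance
(`StrandCompress.lean`) deletes free strand pairs one at a time, largest first, while at least four
strands remain (`AJLCore.compressRaw`, a fuel recursion). Since the strand number `n` of an instance
is written in binary, that loop may run about `n/2` rounds — exponentially many in the input length —
so a polynomial-time digest cannot simulate it round by round. Here we compute its result directly: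

* `touched w` — the pairs `{⌊j/2⌋, ⌊(j+1)/2⌋}` met by the letters `σ_j^{±}` of `w`; a pair is free iff
  it is not touched (`free_iff_not_mem_touched`);
* `rank w p = #{u ∈ touched w | u < p}`, `renum w j = 2·rank w ⌊j/2⌋ + j mod 2` (renumber the touched
  pairs consecutively, keeping the parity of the strand), and the closed form
  `compressCF w = (2·#touched w, w.map (σ_j^{±} ↦ σ_{renum j}^{±}))` (`(2, [])` for the empty word);
* invariance of the closed form under the deletion of one free pair (`compressCF_delPair`: the
  re-indexing `delPair` is a bijection of touched pairs preserving order and ranks), and its value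
  when no pair is free (`compressCF_eq_self`);
* **`compressRaw_eq_compressCF`**: for even `n ≥ 2` and letters in range,
  `compressRaw n w = compressCF w` — in particular the compressed strand number is
  `2·#touched w ≤ 4|w|` and does not depend on `n`; for a valid instance `x`,
  `compressRaw_instance_eq` gives `compressRaw x.1 (rawOf x.toBraidWord) = compressCF x.2.1` (the
  left-hand side is `cword x` of `JonesFinalGlue.lean`).

## References

* D. Aharonov, V. Jones, Z. Landau, Algorithmica 55 (2009) = arXiv:quant-ph/0511096, Thm. 3.2 (the
  plat closure; unlinked circles only contribute loop factors) [AharonovJonesLandau2009].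
* S. Arora, B. Barak, *Computational Complexity: A Modern Approach*, CUP 2009, §1.3 (inputs in
  binary: running time is measured in the bit length) [AroraBarak2009].
-/

namespace Literature.Computability.QuantumComplexity

namespace AJLCore

open Finset

/-! ### Touched pairs -/

/-- The strand pairs touched by the letters of a raw word: `σ_j` joins the strands `j, j+1`, which lie
in the pairs `⌊j/2⌋` and `⌊(j+1)/2⌋`. [folklore] -/
noncomputable def touched (w : List (ℕ × Bool)) : Finset ℕ :=
  w.toFinset.biUnion fun g => ({g.1 / 2, (g.1 + 1) / 2} : Finset ℕ)

/-- Membership in `touched`. [folklore] -/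
theorem mem_touched {w : List (ℕ × Bool)} {l : ℕ} : l ∈ touched w ↔ ∃ g ∈ w, g.1 / 2 = l ∨ (g.1 + 1) / 2 = l := by
  classical
  simp only [touched, mem_biUnion, List.mem_toFinset, mem_insert, mem_singleton]
  exact ⟨fun ⟨g, hg, h⟩ => ⟨g, hg, by omega⟩, fun ⟨g, hg, h⟩ => ⟨g, hg, by omega⟩⟩

/-- **A pair is free iff no letter touches it.** [folklore] -/
theorem free_iff_not_mem_touched {w : List (ℕ × Bool)} {l : ℕ} : Free w l ↔ l ∉ touched w := by
  rw [mem_touched, Free]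
  push Not
  exact ⟨fun h g hg => by have := h g hg; omega, fun h g hg => by have := h g hg; omega⟩

/-- `touched` of a mapped word. [folklore] -/
theorem touched_map (φ : ℕ × Bool → ℕ × Bool) (w : List (ℕ × Bool)) :
    touched (w.map φ) = w.toFinset.biUnion fun g => ({(φ g).1 / 2, ((φ g).1 + 1) / 2} : Finset ℕ) := by
  classical
  ext l
  simp only [touched, mem_biUnion, List.mem_toFinset, List.mem_map]
  constructor
  · rintro ⟨_, ⟨g, hg, rfl⟩, h⟩; exact ⟨g, hg, h⟩
  · rintro ⟨g, hg, h⟩; exact ⟨φ g, ⟨g, hg, rfl⟩, h⟩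

/-- Letters in range touch only pairs below `n/2`. [folklore] -/
theorem touched_subset_range {n : ℕ} {w : List (ℕ × Bool)} (hn : Even n) (hw : ∀ g ∈ w, g.1 < n - 1) :
    touched w ⊆ range (n / 2) := by
  intro l hl
  rw [mem_touched] at hl
  obtain ⟨g, hg, h⟩ := hl
  have := hw g hg
  obtain ⟨a, rfl⟩ := hn
  rw [mem_range]; omega

/-- A nonempty word touches some pair. [folklore] -/
theorem touched_nonempty {w : List (ℕ × Bool)} (hw : w ≠ []) : (touched w).Nonempty := by
  obtain ⟨g, hg⟩ := List.exists_mem_of_ne_nil w hw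
  exact ⟨g.1 / 2, mem_touched.2 ⟨g, hg, Or.inl rfl⟩⟩

/-- `#touched w ≤ 2|w|`. [folklore] -/
theorem card_touched_le (w : List (ℕ × Bool)) : (touched w).card ≤ 2 * w.length := by
  classical
  calc (touched w).card ≤ ∑ g ∈ w.toFinset, ({g.1 / 2, (g.1 + 1) / 2} : Finset ℕ).card := card_biUnion_le
    _ ≤ ∑ _g ∈ w.toFinset, 2 := sum_le_sum fun g _ => card_le_two
    _ = 2 * w.toFinset.card := by rw [sum_const, smul_eq_mul, Nat.mul_comm]
    _ ≤ 2 * w.length := Nat.mul_le_mul_left _ (List.toFinset_card_le w)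

/-! ### The closed form -/

/-- The number of touched pairs below `p`. [folklore] -/
noncomputable def rank (w : List (ℕ × Bool)) (p : ℕ) : ℕ := ((touched w).filter (· < p)).card

/-- The new index of the generator `σ_j` after all free pairs are deleted: the touched pairs are
renumbered consecutively and the parity of the strand is kept. [folklore] -/
noncomputable def renum (w : List (ℕ × Bool)) (j : ℕ) : ℕ := 2 * rank w (j / 2) + j % 2

/-- **The compressed word in closed form**: `2·#touched` strands and renumbered letters (two strands
and no letter for the empty word). [cite: AharonovJonesLandau2009, Thm. 3.2] -/
noncomputable def compressCF (w : List (ℕ × Bool)) : ℕ × List (ℕ × Bool) :=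
  if w = [] then (2, []) else (2 * (touched w).card, w.map fun g => (renum w g.1, g.2))

/-! ### Deleting one free pair does not change the closed form -/

section DelPair

variable {w : List (ℕ × Bool)} {l : ℕ}

/-- The re-indexing of pairs when the pair `l` is deleted. [folklore] -/
def pairShift (l u : ℕ) : ℕ := if u < l then u else u - 1

/-- The index map of `delPair`. [folklore] -/
theorem delPair_eq_map (l : ℕ) (w : List (ℕ × Bool)) :
    delPair l w = w.map fun g => (if g.1 < 2 * l then g.1 else g.1 - 2, g.2) := rfl

/-- A letter not touching the pair `l` moves to the shifted pairs. [folklore] -/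
theorem div_two_delIdx {j l : ℕ} (hj : j + 1 ≠ 2 * l ∧ j ≠ 2 * l ∧ j ≠ 2 * l + 1) :
    (if j < 2 * l then j else j - 2) / 2 = pairShift l (j / 2) ∧
      ((if j < 2 * l then j else j - 2) + 1) / 2 = pairShift l ((j + 1) / 2) := by
  unfold pairShift
  constructor <;> split_ifs <;> omega

/-- `pairShift l` is injective away from `l`. [folklore] -/
theorem pairShift_injOn (l : ℕ) : Set.InjOn (pairShift l) {u | u ≠ l} := by
  intro u hu v hv h
  simp only [Set.mem_setOf_eq] at hu hv
  unfold pairShift at h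
  split_ifs at h <;> omega

/-- `pairShift l` is strictly monotone away from `l`. [folklore] -/
theorem pairShift_lt_iff {l u v : ℕ} (hu : u ≠ l) (hv : v ≠ l) : pairShift l u < pairShift l v ↔ u < v := by
  unfold pairShift
  split_ifs <;> omega

/-- **Touched pairs after a deletion** are the shifted touched pairs. [folklore] -/
theorem touched_delPair (hl : l ∉ touched w) : touched (delPair l w) = (touched w).image (pairShift l) := by
  classical
  rw [delPair_eq_map, touched_map, touched, biUnion_image]
  refine biUnion_congr rfl fun g hg => ?_
  rw [List.mem_toFinset] at hg
  have hfree : Free w l := free_iff_not_mem_touched.2 hl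
  obtain ⟨h1, h2⟩ := div_two_delIdx (hfree g hg)
  rw [h1, h2, image_insert, image_singleton]

/-- The number of touched pairs is unchanged by a deletion. [folklore] -/
theorem card_touched_delPair (hl : l ∉ touched w) : (touched (delPair l w)).card = (touched w).card := by
  rw [touched_delPair hl]
  exact card_image_of_injOn fun u hu v hv h => pairShift_injOn l (ne_of_mem_of_not_mem hu hl) (ne_of_mem_of_not_mem hv hl) h

/-- Ranks are unchanged by a deletion (at shifted pairs away from `l`). [folklore] -/
theorem rank_delPair (hl : l ∉ touched w) {p : ℕ} (hp : p ≠ l) : rank (delPair l w) (pairShift l p) = rank w p := by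
  classical
  unfold rank
  rw [touched_delPair hl, filter_image, card_image_of_injOn]
  · congr 1
    ext u
    simp only [mem_filter, and_congr_right_iff]
    exact fun hu => pairShift_lt_iff (ne_of_mem_of_not_mem hu hl) hp
  · intro u hu v hv h
    rw [coe_filter] at hu hv
    exact pairShift_injOn l (ne_of_mem_of_not_mem hu.1 hl) (ne_of_mem_of_not_mem hv.1 hl) h

/-- New indices are unchanged by a deletion. [folklore] -/
theorem renum_delPair (hl : l ∉ touched w) {j : ℕ} (hj : j + 1 ≠ 2 * l ∧ j ≠ 2 * l ∧ j ≠ 2 * l + 1) :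
    renum (delPair l w) (if j < 2 * l then j else j - 2) = renum w j := by
  unfold renum
  rw [(div_two_delIdx hj).1, rank_delPair hl (by omega)]
  split_ifs <;> omega

/-- **The closed form is invariant under the deletion of a free pair.** [folklore] -/
theorem compressCF_delPair (hfree : Free w l) : compressCF (delPair l w) = compressCF w := by
  have hl : l ∉ touched w := free_iff_not_mem_touched.1 hfree
  unfold compressCF
  by_cases hw : w = []
  · subst hw; rfl
  · have hw' : delPair l w ≠ [] := by rw [delPair_eq_map]; simpa using hw
    rw [if_neg hw, if_neg hw', card_touched_delPair hl, delPair_eq_map, List.map_map]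
    congr 1
    refine List.map_congr_left fun g hg => ?_
    simp only [Function.comp_apply, Prod.mk.injEq, and_true]
    exact renum_delPair hl (hfree g hg)

end DelPair

/-! ### When no pair is free the closed form is the word itself -/

/-- If every pair below `n/2` is touched (and letters are in range), the closed form is `(n, w)`.
[folklore] -/
theorem compressCF_eq_self {n : ℕ} {w : List (ℕ × Bool)} (hn : Even n) (hw : w ≠ [])
    (ht : touched w = range (n / 2)) : compressCF w = (n, w) := by
  unfold compressCF
  rw [if_neg hw, ht, card_range, Nat.two_mul_div_two_of_even hn]
  congr 1
  conv_rhs => rw [← List.map_id w]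
  refine List.map_congr_left fun g hg => ?_
  have hj : g.1 / 2 < n / 2 := by
    have : g.1 / 2 ∈ touched w := mem_touched.2 ⟨g, hg, Or.inl rfl⟩
    rw [ht, mem_range] at this; exact this
  have hr : rank w (g.1 / 2) = g.1 / 2 := by
    unfold rank
    rw [ht, show (range (n / 2)).filter (· < g.1 / 2) = range (g.1 / 2) by ext u; simp only [mem_filter, mem_range]; omega,
      card_range]
  rw [id, renum, hr]
  refine Prod.ext ?_ rfl
  simp only
  omega

/-- No free pair below `n/2` and letters in range: the touched pairs are exactly `range (n/2)`. [folklore] -/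
theorem touched_eq_range {n : ℕ} {w : List (ℕ × Bool)} (hn : Even n) (hw : ∀ g ∈ w, g.1 < n - 1)
    (hall : ∀ l < n / 2, ¬ Free w l) : touched w = range (n / 2) := by
  refine Subset.antisymm (touched_subset_range hn hw) fun l hl => ?_
  rw [mem_range] at hl
  have h := hall l hl
  rw [free_iff_not_mem_touched, not_not] at h
  exact h

/-! ### The fuel recursion computes the closed form -/

/-- The fuel recursion with enough fuel computes the closed form. [cite: AharonovJonesLandau2009, Thm. 3.2] -/
theorem compressFuel_eq_compressCF : ∀ (f n : ℕ) (w : List (ℕ × Bool)), Even n → 2 ≤ n → (∀ g ∈ w, g.1 < n - 1) →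
    n / 2 ≤ f + 1 → compressFuel f n w = compressCF w
  | 0, n, w, hn, h2, hw, hf => by
    -- `n = 2`: nothing to delete
    have hn2 : n = 2 := by obtain ⟨a, ha⟩ := hn; omega
    subst hn2
    show ((2 : ℕ), w) = compressCF w
    by_cases hw0 : w = []
    · subst hw0; rfl
    · refine (compressCF_eq_self hn hw0 ?_).symm
      refine Subset.antisymm (touched_subset_range hn hw) ?_
      obtain ⟨u, hu⟩ := touched_nonempty hw0
      have hu' := touched_subset_range hn hw hu
      intro l hl
      simp only [Nat.reduceDiv, range_one, mem_singleton] at hl hu'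
      rw [hl, ← hu']; exact hu
  | f + 1, n, w, hn, h2, hw, hf => by
    by_cases h4 : 4 ≤ n
    · cases hfind : findFree (n - 2) w with
      | none =>
        have e : compressFuel (f + 1) n w = (n, w) := by simp [compressFuel, h4, hfind]
        rw [e]
        -- no pair of the braid on `n` strands is free
        have hall : ∀ l < n / 2, ¬ Free w l := by
          intro l hl hfree
          unfold findFree at hfind
          have := List.find?_eq_none.1 hfind l (by rw [List.mem_reverse, List.mem_range]; omega)
          exact this (decide_eq_true hfree)
        have hw0 : w ≠ [] := by
          rintro rfl
          exact hall 0 (by omega) fun g hg => by simp at hg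
        exact (compressCF_eq_self hn hw0 (touched_eq_range hn hw hall)).symm
      | some l =>
        have e : compressFuel (f + 1) n w = compressFuel f (n - 2) (delPair l w) := by simp [compressFuel, h4, hfind]
        rw [e]
        obtain ⟨m, rfl⟩ : ∃ m, n = m + 2 := ⟨n - 2, by omega⟩
        simp only [Nat.add_sub_cancel] at hfind ⊢
        obtain ⟨hfree, hl⟩ := findFree_spec hfind
        have hm : Even m := by obtain ⟨a, ha⟩ := hn; exact ⟨a - 1, by omega⟩
        have hw' : ∀ g ∈ w, g.1 < m + 1 := fun g hg => by have := hw g hg; omega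
        rw [compressFuel_eq_compressCF f m (delPair l w) hm (by omega) (delPair_lt hl w hw' hfree) (by omega)]
        exact compressCF_delPair hfree
    · have e : compressFuel (f + 1) n w = (n, w) := by simp [compressFuel, h4]
      rw [e]
      have hn2 : n = 2 := by obtain ⟨a, ha⟩ := hn; omega
      subst hn2
      exact compressFuel_eq_compressCF 0 2 w hn h2 hw (by norm_num)

/-- **The compression in closed form**: for an even number `n ≥ 2` of strands and letters in range,
deleting free pairs largest-first while four strands remain ends with `2·#touched w` strands (two for
the empty word) and the letters renumbered by rank — independently of `n`. [cite: AharonovJonesLandau2009, Thm. 3.2] -/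
theorem compressRaw_eq_compressCF {n : ℕ} (hn : Even n) (h2 : 2 ≤ n) (w : List (ℕ × Bool)) (hw : ∀ g ∈ w, g.1 < n - 1) :
    compressRaw n w = compressCF w :=
  compressFuel_eq_compressCF _ n w hn h2 hw (by omega)

/-- The compressed strand number is at most `max 2 (4|w|)`. [folklore] -/
theorem compressCF_fst_le (w : List (ℕ × Bool)) : (compressCF w).1 ≤ max 2 (4 * w.length) := by
  unfold compressCF
  split_ifs
  · exact le_max_left _ _
  · have := card_touched_le w; omega

/-- The compressed word has as many letters as the word. [folklore] -/
theorem length_compressCF_snd (w : List (ℕ × Bool)) : (compressCF w).2.length = w.length := by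
  unfold compressCF
  split_ifs with h
  · subst h; rfl
  · exact List.length_map _

/-! ### Valid instances -/

/-- On a valid instance the raw letters of the braid word are the instance's letter list. [folklore] -/
theorem rawOf_toBraidWord (x : RawJonesInstance) (hx : ∀ g ∈ x.2.1, g.1 < x.1 - 1) : rawOf x.toBraidWord = x.2.1 := by
  obtain ⟨n, wd, r⟩ := x
  simp only [RawJonesInstance.toBraidWord, rawOf] at hx ⊢
  induction wd with
  | nil => rfl
  | cons g wd ih =>
    have hg : g.1 < n - 1 := hx g (by simp)
    rw [List.filterMap_cons, dif_pos hg, List.map_cons, ih fun g' hg' => hx g' (by simp [hg'])]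

/-- **The compressed instance word of a valid instance, in closed form.** [cite: AharonovJonesLandau2009, Thm. 3.2] -/
theorem compressRaw_instance_eq (x : RawJonesInstance) (hx : x.IsValid) :
    compressRaw x.1 (rawOf x.toBraidWord) = compressCF x.2.1 := by
  rw [rawOf_toBraidWord x hx.2.2.1]
  exact compressRaw_eq_compressCF hx.1 hx.2.1 _ hx.2.2.1

end AJLCore

end Literature.Computability.QuantumComplexity
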